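import Literature.Probability.LatticeModels.SahiThirdOrderCorrelation
import Literature.Probability.LatticeModels.StrongHarrisKleitman
import Literature.Probability.Percolation.PercolationEvents
import HarnessLib

/-!
# Sahi's third-order functional on the complements of a three-petal sunflower, and the
# four-point "perfect matching" separation triple

Topics `Literature/Probability/LatticeModels` (the abstract part) and `Literature/Probability/Percolation`
(the bond-percolation instance).  Everything in this file is PROVED; no definition and no named fact is
introduced.

## Sources, as printed, and status

* Sahi's functional (tree `Literature.Probability.LatticeModels.sahiE3`):
  `E₃(A,B,C) = 2μ(ABC) + μ(A)μ(B)μ(C) − μ(A)μ(BC) − μ(B)μ(AC) − μ(C)μ(AB)`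
  [cite: LiebSahi2021, eq. (2.1) (arXiv p. 5)];  "**Conjecture 5.** For a product measure `μ` and
  increasing `A, B, C ⊆ Ω`, `2μ(ABC) − [μ(AB)μ(C) + μ(AC)μ(B) + μ(BC)μ(A)] + μ(A)μ(B)μ(C) ≥ 0`"
  [cite: Kahn2022, Conjecture 5 (arXiv p. 3)] (equivalently for decreasing events, `p ↦ 1 − p`); OPEN.
  The proved class: "**Theorem 8.6** For any n-tuple of functions `f₁, …, f_n` in `𝔠(X)` [cumulations
  `F⁺(T) = Σ_{S ⊆ T} F(S)` of positive `F`, i.e. nonnegative combinations of indicators of principal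
  up-sets], and any `μ` satisfying [the FKG lattice condition], `E_n(f₁,…,f_n) ≥ 0`."
  [cite: Johnson2019GroupMatrices, §8.3.2, Thm. 8.5–8.6 (Sahi's theorem)] (in the primary source,
  [Sahi2008, Thm. 2 (p. 211)], the measure is a PRODUCT measure; the FKG-measure version of the same class is
  [Blinovsky2013]); the events below are not in it.
* Gladkov's strong Harris–Kleitman inequality, `k = 3`, sunflower form (tree
  `prodBernoulli_strongHarris_sunflower_three`): for increasing `E₁, E₂, E₃` with all pairwise
  intersections equal to `A`, `e₂(μ(E_i ∖ A)) ≤ μ(A)·μ((E₁ ∪ E₂ ∪ E₃)ᶜ)`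
  [cite: Gladkov2024StrongFKG, Thm. 2.1].

## What is proved here (bookkeeping + corollaries; not stated in the sources)

Write, for three events `U₁, U₂, U₃` whose pairwise intersections all equal `A` (a "sunflower of
events" with core `A` and petals `C_i = U_i ∖ A`), `a = μ(A)`, `c_i = μ(U_i ∖ A)`,
`b = μ((U₁ ∪ U₂ ∪ U₃)ᶜ)`, `e₂ = c₁c₂ + c₁c₃ + c₂c₃`, `e₃ = c₁c₂c₃` (so `a + b + c₁ + c₂ + c₃ = 1`).
* `sahiE3_compl` — the complement rule `E₃(Aᶜ,Bᶜ,Cᶜ) = Cov(A,B) + Cov(A,C) + Cov(B,C) − E₃(A,B,C)`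
  (any probability measure, any three events).
* `sahiE3_compl_sunflower_eq` — `E₃(U₁ᶜ,U₂ᶜ,U₃ᶜ) = (1 + a)·(a·b − e₂) − e₃`;
  `sahiE3_sunflower_eq` — `E₃(U₁,U₂,U₃) = a(1 − a)(2 − a − c₁ − c₂ − c₃) + a·e₂ + e₃`, hence
  `sahiE3_sunflower_nonneg` — `E₃(U₁,U₂,U₃) ≥ 0` for EVERY probability measure (the 'increasing' triple of
  a sunflower is never the issue).
* `prodBernoulli_sahiE3_compl_sunflower_ge` — for a product measure and increasing `U_i`:
  `E₃(U₁ᶜ,U₂ᶜ,U₃ᶜ) ≥ −e₃`, from Gladkov's theorem (`a·b ≥ e₂`).  Whether `E₃(U₁ᶜ,U₂ᶜ,U₃ᶜ) ≥ 0`, i.e.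
  `(1 + a)(a·b − e₂) ≥ e₃`, is the instance of the open conjecture for complements of sunflowers.
* The four-point instance (`o, a₁, a₂, a₃` vertices of a finite weighted graph): the three increasing events
  `U_k = {o ↔ a_k} ∪ {a_i ↔ a_j}` (`{i,j,k} = {1,2,3}`; one for each perfect matching of `K₄`) form a
  sunflower whose core is "some three of the four vertices are mutually joined"
  (`openConn_matching_inter₁₂/₁₃/₂₃`); hence for the three DECREASING events
  `D_k = {o ↮ a_k} ∩ {a_i ↮ a_j}`:  `E₃(D₁,D₂,D₃) = (1 + R)(R·Q − e₂(x)) − e₃(x)` with `R = μ(core)`,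
  `Q = μ(no two of the four joined)`, `x_k = μ(U_k ∖ core)` (`prodBernoulli_sahiE3_fourPointMatching_eq`),
  and the proved part `E₃(D₁,D₂,D₃) ≥ −x₁x₂x₃` (`prodBernoulli_sahiE3_fourPointMatching_ge`).  The
  three-point pairwise-separation triple of `SahiThreePointSeparation.lean` is the same abstract statement
  with `U_k = {pair k joined}`, core `{all three joined}`.
* `measureReal_compl_sunflower_condCov_eq` — for ANY law, `μ(U₃ᶜ)μ(U₁ᶜ∩U₂ᶜ∩U₃ᶜ) − μ(U₁ᶜ∩U₃ᶜ)μ(U₂ᶜ∩U₃ᶜ)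
  = −c₁c₂`: two sunflower complements are conditionally NEGATIVELY correlated given the third (the
  conditional covariance is minus a petal product), so the conditional-correlation criterion of
  `SahiThirdOrderCorrelation.lean` (`SahiE3.nonneg_of_condCov`, the mechanism of the printed proved cases
  [Sahi2008, Thm. 2; Blinovsky2013]) never applies on this family unless a petal is null;
  `sahiE3_compl_sunflower_mul_eq` — Blinovsky's chain specialised:
  `μ(U₃ᶜ)·E₃(U₁ᶜ,U₂ᶜ,U₃ᶜ) = −c₁c₂ + μ(U₃ᶜ)·[Harris slack of (U₁ᶜ∩U₂ᶜ, U₃ᶜ)] + [slack (U₁ᶜ,U₃ᶜ)]·[slack (U₂ᶜ,U₃ᶜ)]`,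
  i.e. on sunflower complements Sahi's inequality says "two Harris slacks pay for a petal product";
  `prodBernoulli_fourPointMatching_condCov_eq` — the four-point instance (`= −x₁x₂`).
-/

namespace Literature.Probability.LatticeModels

open MeasureTheory

section General

variable {Ω : Type*} [MeasurableSpace Ω] (μ : Measure Ω) [IsProbabilityMeasure μ]

/-- **Complement rule for Sahi's functional.**  For any probability measure and measurable `A, B, C`:
`E₃(Aᶜ,Bᶜ,Cᶜ) = [μ(AB) − μ(A)μ(B)] + [μ(AC) − μ(A)μ(C)] + [μ(BC) − μ(B)μ(C)] − E₃(A,B,C)`.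
(Inclusion–exclusion; not stated in the sources.) [cite: LiebSahi2021, eq. (2.1) (arXiv p. 5)] -/
theorem sahiE3_compl {A B C : Set Ω} (hA : MeasurableSet A) (hB : MeasurableSet B)
    (hC : MeasurableSet C) :
    sahiE3 μ Aᶜ Bᶜ Cᶜ =
      (μ.real (A ∩ B) - μ.real A * μ.real B) + (μ.real (A ∩ C) - μ.real A * μ.real C) +
          (μ.real (B ∩ C) - μ.real B * μ.real C) - sahiE3 μ A B C := by
  have hAB : μ.real (A ∪ B) = μ.real A + μ.real B - μ.real (A ∩ B) := by
    have h := measureReal_union_add_inter (μ := μ) (s := A) hB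
    linarith
  have hAC : μ.real (A ∪ C) = μ.real A + μ.real C - μ.real (A ∩ C) := by
    have h := measureReal_union_add_inter (μ := μ) (s := A) hC
    linarith
  have hBC : μ.real (B ∪ C) = μ.real B + μ.real C - μ.real (B ∩ C) := by
    have h := measureReal_union_add_inter (μ := μ) (s := B) hC
    linarith
  have hI : μ.real ((A ∪ B) ∩ C) = μ.real (A ∩ C) + μ.real (B ∩ C) - μ.real (A ∩ B ∩ C) := by
    rw [Set.union_inter_distrib_right]
    have h := measureReal_union_add_inter (μ := μ) (s := A ∩ C) (hB.inter hC)
    have e : A ∩ C ∩ (B ∩ C) = A ∩ B ∩ C := by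
      ext ω
      simp only [Set.mem_inter_iff]
      tauto
    rw [e] at h
    linarith
  have hABC : μ.real (A ∪ B ∪ C) = μ.real A + μ.real B + μ.real C - μ.real (A ∩ B) -
      μ.real (A ∩ C) - μ.real (B ∩ C) + μ.real (A ∩ B ∩ C) := by
    have h := measureReal_union_add_inter (μ := μ) (s := A ∪ B) hC
    rw [hI, hAB] at h
    linarith
  have c1 : μ.real Aᶜ = 1 - μ.real A := probReal_compl_eq_one_sub hA
  have c2 : μ.real Bᶜ = 1 - μ.real B := probReal_compl_eq_one_sub hB
  have c3 : μ.real Cᶜ = 1 - μ.real C := probReal_compl_eq_one_sub hC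
  have c12 : μ.real (Aᶜ ∩ Bᶜ) = 1 - (μ.real A + μ.real B - μ.real (A ∩ B)) := by
    rw [← Set.compl_union, probReal_compl_eq_one_sub (hA.union hB), hAB]
  have c13 : μ.real (Aᶜ ∩ Cᶜ) = 1 - (μ.real A + μ.real C - μ.real (A ∩ C)) := by
    rw [← Set.compl_union, probReal_compl_eq_one_sub (hA.union hC), hAC]
  have c23 : μ.real (Bᶜ ∩ Cᶜ) = 1 - (μ.real B + μ.real C - μ.real (B ∩ C)) := by
    rw [← Set.compl_union, probReal_compl_eq_one_sub (hB.union hC), hBC]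
  have c123 : μ.real (Aᶜ ∩ Bᶜ ∩ Cᶜ) = 1 - (μ.real A + μ.real B + μ.real C - μ.real (A ∩ B) -
      μ.real (A ∩ C) - μ.real (B ∩ C) + μ.real (A ∩ B ∩ C)) := by
    rw [← Set.compl_union, ← Set.compl_union, probReal_compl_eq_one_sub ((hA.union hB).union hC),
      hABC]
  rw [sahiE3_def, sahiE3_def, c123, c1, c2, c3, c23, c13, c12]
  ring

variable {U₁ U₂ U₃ A : Set Ω}

/-- Inclusion–exclusion for a three-event sunflower: if all pairwise intersections of `U₁, U₂, U₃`
equal `A`, then `μ(U₁ ∪ U₂ ∪ U₃) = μ(U₁) + μ(U₂) + μ(U₃) − 2μ(A)`. [folklore] -/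
theorem measureReal_union₃_of_pairwise_inter_eq (h₂ : MeasurableSet U₂) (h₃ : MeasurableSet U₃)
    (h12 : U₁ ∩ U₂ = A) (h13 : U₁ ∩ U₃ = A) (h23 : U₂ ∩ U₃ = A) :
    μ.real (U₁ ∪ U₂ ∪ U₃) = μ.real U₁ + μ.real U₂ + μ.real U₃ - 2 * μ.real A := by
  have hU12 : μ.real (U₁ ∪ U₂) = μ.real U₁ + μ.real U₂ - μ.real A := by
    have h := measureReal_union_add_inter (μ := μ) (s := U₁) h₂
    rw [h12] at h
    linarith
  have h := measureReal_union_add_inter (μ := μ) (s := U₁ ∪ U₂) h₃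
  rw [Set.union_inter_distrib_right, h13, h23, Set.union_self, hU12] at h
  linarith

/-- **Sahi's functional on the complements of a three-petal sunflower of events.**  For a probability
measure `μ` and measurable `U₁, U₂, U₃` with `U₁ ∩ U₂ = U₁ ∩ U₃ = U₂ ∩ U₃ = A`, writing `a = μ(A)`,
`c_i = μ(U_i ∖ A)`, `b = μ((U₁ ∪ U₂ ∪ U₃)ᶜ)`:
`E₃(U₁ᶜ, U₂ᶜ, U₃ᶜ) = (1 + a)·(a·b − (c₁c₂ + c₁c₃ + c₂c₃)) − c₁c₂c₃`.
(Measure bookkeeping; not stated in the sources.  With `U_i` increasing under a product measure,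
`a·b ≥ c₁c₂ + c₁c₃ + c₂c₃` is [Gladkov2024StrongFKG, Thm. 2.1] for `k = 3`.)
[cite: LiebSahi2021, eq. (2.1) (arXiv p. 5); Gladkov2024StrongFKG, Thm. 2.1] -/
theorem sahiE3_compl_sunflower_eq (h₁ : MeasurableSet U₁) (h₂ : MeasurableSet U₂)
    (h₃ : MeasurableSet U₃) (h12 : U₁ ∩ U₂ = A) (h13 : U₁ ∩ U₃ = A) (h23 : U₂ ∩ U₃ = A) :
    sahiE3 μ U₁ᶜ U₂ᶜ U₃ᶜ =
      (1 + μ.real A) *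
          (μ.real A * μ.real (U₁ ∪ U₂ ∪ U₃)ᶜ -
            (μ.real (U₁ \ A) * μ.real (U₂ \ A) + μ.real (U₁ \ A) * μ.real (U₃ \ A) +
              μ.real (U₂ \ A) * μ.real (U₃ \ A))) -
        μ.real (U₁ \ A) * μ.real (U₂ \ A) * μ.real (U₃ \ A) := by
  have hA : MeasurableSet A := by rw [← h12]; exact h₁.inter h₂
  -- petals
  have hAU₁ : U₁ ∩ A = A := by
    rw [Set.inter_eq_right, ← h12]; exact Set.inter_subset_left
  have hAU₂ : U₂ ∩ A = A := by
    rw [Set.inter_eq_right, ← h12]; exact Set.inter_subset_right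
  have hAU₃ : U₃ ∩ A = A := by
    rw [Set.inter_eq_right, ← h13]; exact Set.inter_subset_right
  have d₁ : μ.real (U₁ \ A) = μ.real U₁ - μ.real A := by
    have h := measureReal_inter_add_sdiff (μ := μ) (s := U₁) hA
    rw [hAU₁] at h
    linarith
  have d₂ : μ.real (U₂ \ A) = μ.real U₂ - μ.real A := by
    have h := measureReal_inter_add_sdiff (μ := μ) (s := U₂) hA
    rw [hAU₂] at h
    linarith
  have d₃ : μ.real (U₃ \ A) = μ.real U₃ - μ.real A := by
    have h := measureReal_inter_add_sdiff (μ := μ) (s := U₃) hA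
    rw [hAU₃] at h
    linarith
  -- unions
  have hU12 : μ.real (U₁ ∪ U₂) = μ.real U₁ + μ.real U₂ - μ.real A := by
    have h := measureReal_union_add_inter (μ := μ) (s := U₁) h₂
    rw [h12] at h
    linarith
  have hU13 : μ.real (U₁ ∪ U₃) = μ.real U₁ + μ.real U₃ - μ.real A := by
    have h := measureReal_union_add_inter (μ := μ) (s := U₁) h₃
    rw [h13] at h
    linarith
  have hU23 : μ.real (U₂ ∪ U₃) = μ.real U₂ + μ.real U₃ - μ.real A := by
    have h := measureReal_union_add_inter (μ := μ) (s := U₂) h₃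
    rw [h23] at h
    linarith
  have hU123 := measureReal_union₃_of_pairwise_inter_eq μ h₂ h₃ h12 h13 h23
  -- complements
  have c1 : μ.real U₁ᶜ = 1 - μ.real U₁ := probReal_compl_eq_one_sub h₁
  have c2 : μ.real U₂ᶜ = 1 - μ.real U₂ := probReal_compl_eq_one_sub h₂
  have c3 : μ.real U₃ᶜ = 1 - μ.real U₃ := probReal_compl_eq_one_sub h₃
  have c12 : μ.real (U₁ᶜ ∩ U₂ᶜ) = 1 - (μ.real U₁ + μ.real U₂ - μ.real A) := by
    rw [← Set.compl_union, probReal_compl_eq_one_sub (h₁.union h₂), hU12]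
  have c13 : μ.real (U₁ᶜ ∩ U₃ᶜ) = 1 - (μ.real U₁ + μ.real U₃ - μ.real A) := by
    rw [← Set.compl_union, probReal_compl_eq_one_sub (h₁.union h₃), hU13]
  have c23 : μ.real (U₂ᶜ ∩ U₃ᶜ) = 1 - (μ.real U₂ + μ.real U₃ - μ.real A) := by
    rw [← Set.compl_union, probReal_compl_eq_one_sub (h₂.union h₃), hU23]
  have c123 : μ.real (U₁ᶜ ∩ U₂ᶜ ∩ U₃ᶜ) =
      1 - (μ.real U₁ + μ.real U₂ + μ.real U₃ - 2 * μ.real A) := by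
    rw [← Set.compl_union, ← Set.compl_union, probReal_compl_eq_one_sub ((h₁.union h₂).union h₃),
      hU123]
  have cB : μ.real (U₁ ∪ U₂ ∪ U₃)ᶜ = 1 - (μ.real U₁ + μ.real U₂ + μ.real U₃ - 2 * μ.real A) := by
    rw [probReal_compl_eq_one_sub ((h₁.union h₂).union h₃), hU123]
  rw [sahiE3_def, c123, c1, c2, c3, c23, c13, c12, cB, d₁, d₂, d₃]
  ring

/-- **Sahi's functional on a three-petal sunflower of events (closed form).**  With the notation of
`sahiE3_compl_sunflower_eq`:
`E₃(U₁, U₂, U₃) = a(1 − a)(2 − a − c₁ − c₂ − c₃) + a·(c₁c₂ + c₁c₃ + c₂c₃) + c₁c₂c₃`.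
(Measure bookkeeping; not stated in the sources.) [cite: LiebSahi2021, eq. (2.1) (arXiv p. 5)] -/
theorem sahiE3_sunflower_eq (h₁ : MeasurableSet U₁) (h₂ : MeasurableSet U₂)
    (h12 : U₁ ∩ U₂ = A) (h13 : U₁ ∩ U₃ = A) (h23 : U₂ ∩ U₃ = A) :
    sahiE3 μ U₁ U₂ U₃ =
      μ.real A * (1 - μ.real A) *
            (2 - μ.real A - μ.real (U₁ \ A) - μ.real (U₂ \ A) - μ.real (U₃ \ A)) +
          μ.real A *
            (μ.real (U₁ \ A) * μ.real (U₂ \ A) + μ.real (U₁ \ A) * μ.real (U₃ \ A) +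
              μ.real (U₂ \ A) * μ.real (U₃ \ A)) +
        μ.real (U₁ \ A) * μ.real (U₂ \ A) * μ.real (U₃ \ A) := by
  have hA : MeasurableSet A := by rw [← h12]; exact h₁.inter h₂
  have hAU₁ : U₁ ∩ A = A := by
    rw [Set.inter_eq_right, ← h12]; exact Set.inter_subset_left
  have hAU₂ : U₂ ∩ A = A := by
    rw [Set.inter_eq_right, ← h12]; exact Set.inter_subset_right
  have hAU₃ : U₃ ∩ A = A := by
    rw [Set.inter_eq_right, ← h13]; exact Set.inter_subset_right
  have d₁ : μ.real (U₁ \ A) = μ.real U₁ - μ.real A := by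
    have h := measureReal_inter_add_sdiff (μ := μ) (s := U₁) hA
    rw [hAU₁] at h
    linarith
  have d₂ : μ.real (U₂ \ A) = μ.real U₂ - μ.real A := by
    have h := measureReal_inter_add_sdiff (μ := μ) (s := U₂) hA
    rw [hAU₂] at h
    linarith
  have d₃ : μ.real (U₃ \ A) = μ.real U₃ - μ.real A := by
    have h := measureReal_inter_add_sdiff (μ := μ) (s := U₃) hA
    rw [hAU₃] at h
    linarith
  have h123 : U₁ ∩ U₂ ∩ U₃ = A := by rw [h12, Set.inter_comm]; exact hAU₃
  rw [sahiE3_def, h123, h23, h13, h12, d₁, d₂, d₃]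
  ring

/-- **The 'increasing' triple of a sunflower is nonnegative for every probability measure:**
`E₃(U₁, U₂, U₃) ≥ 0` whenever `U₁ ∩ U₂ = U₁ ∩ U₃ = U₂ ∩ U₃` (no monotonicity, no product structure
needed).  (Not stated in the sources; it says that on sunflowers only the complementary triple of
[Kahn2022, Conjecture 5] has content.) [cite: Kahn2022, Conjecture 5 (arXiv p. 3)] -/
theorem sahiE3_sunflower_nonneg (h₁ : MeasurableSet U₁) (h₂ : MeasurableSet U₂)
    (h₃ : MeasurableSet U₃) (h12 : U₁ ∩ U₂ = A) (h13 : U₁ ∩ U₃ = A) (h23 : U₂ ∩ U₃ = A) :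
    0 ≤ sahiE3 μ U₁ U₂ U₃ := by
  rw [sahiE3_sunflower_eq μ h₁ h₂ h12 h13 h23]
  have hA : MeasurableSet A := by rw [← h12]; exact h₁.inter h₂
  have hAU₁ : U₁ ∩ A = A := by
    rw [Set.inter_eq_right, ← h12]; exact Set.inter_subset_left
  have hAU₂ : U₂ ∩ A = A := by
    rw [Set.inter_eq_right, ← h12]; exact Set.inter_subset_right
  have hAU₃ : U₃ ∩ A = A := by
    rw [Set.inter_eq_right, ← h13]; exact Set.inter_subset_right
  have d₁ : μ.real (U₁ \ A) = μ.real U₁ - μ.real A := by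
    have h := measureReal_inter_add_sdiff (μ := μ) (s := U₁) hA
    rw [hAU₁] at h
    linarith
  have d₂ : μ.real (U₂ \ A) = μ.real U₂ - μ.real A := by
    have h := measureReal_inter_add_sdiff (μ := μ) (s := U₂) hA
    rw [hAU₂] at h
    linarith
  have d₃ : μ.real (U₃ \ A) = μ.real U₃ - μ.real A := by
    have h := measureReal_inter_add_sdiff (μ := μ) (s := U₃) hA
    rw [hAU₃] at h
    linarith
  have hU123 := measureReal_union₃_of_pairwise_inter_eq μ h₂ h₃ h12 h13 h23
  have hle : μ.real (U₁ ∪ U₂ ∪ U₃) ≤ 1 := measureReal_le_one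
  have ha0 : 0 ≤ μ.real A := measureReal_nonneg
  have ha1 : μ.real A ≤ 1 := measureReal_le_one
  have hc₁ : 0 ≤ μ.real (U₁ \ A) := measureReal_nonneg
  have hc₂ : 0 ≤ μ.real (U₂ \ A) := measureReal_nonneg
  have hc₃ : 0 ≤ μ.real (U₃ \ A) := measureReal_nonneg
  have hs : 0 ≤ 2 - μ.real A - μ.real (U₁ \ A) - μ.real (U₂ \ A) - μ.real (U₃ \ A) := by
    rw [d₁, d₂, d₃]; linarith
  have t1 : 0 ≤ μ.real A * (1 - μ.real A) *
      (2 - μ.real A - μ.real (U₁ \ A) - μ.real (U₂ \ A) - μ.real (U₃ \ A)) :=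
    mul_nonneg (mul_nonneg ha0 (by linarith)) hs
  have t2 : 0 ≤ μ.real A *
      (μ.real (U₁ \ A) * μ.real (U₂ \ A) + μ.real (U₁ \ A) * μ.real (U₃ \ A) +
        μ.real (U₂ \ A) * μ.real (U₃ \ A)) :=
    mul_nonneg ha0 (by positivity)
  have t3 : 0 ≤ μ.real (U₁ \ A) * μ.real (U₂ \ A) * μ.real (U₃ \ A) := by positivity
  linarith

/-- **On the complements of a three-petal sunflower each pair is conditionally NEGATIVELY correlated
given the third complement: the conditional covariance is minus a petal product.**  For a probability
measure `μ` and measurable `U₁, U₂, U₃` with `U₁ ∩ U₂ = U₁ ∩ U₃ = U₂ ∩ U₃ = A` (petals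
`c_i = μ(U_i ∖ A)`):
`μ(U₃ᶜ)·μ(U₁ᶜ ∩ U₂ᶜ ∩ U₃ᶜ) − μ(U₁ᶜ ∩ U₃ᶜ)·μ(U₂ᶜ ∩ U₃ᶜ) = −c₁·c₂`,
i.e. `μ(U₃ᶜ)²·Cov(1_{U₁ᶜ}, 1_{U₂ᶜ} | U₃ᶜ) = −c₁c₂ ≤ 0` for EVERY law (by the symmetry of the hypotheses
the same holds for the other two choices of the conditioning set).  Consequently the hypothesis of the
conditional-correlation criterion `SahiE3.nonneg_of_condCov` / `prodBernoulli_sahiE3_nonneg_of_condHarris`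
— the mechanism of the printed proved cases of Sahi's conjecture ([Blinovsky2013, Appendix]: the chain
`SahiE3.mul_eq`; [Sahi2008, Thm. 2] covers the same class by another route) — is met on this family only
when a petal is null: those proofs have no foothold on sunflower complements such as the four-point
matching separations below.  (Measure bookkeeping; not stated in the sources.)
[cite: Blinovsky2013, Appendix (arXiv text p. 3); Kahn2022, Conjecture 5 (arXiv p. 3)] -/
theorem measureReal_compl_sunflower_condCov_eq (h₁ : MeasurableSet U₁) (h₂ : MeasurableSet U₂)
    (h₃ : MeasurableSet U₃) (h12 : U₁ ∩ U₂ = A) (h13 : U₁ ∩ U₃ = A) (h23 : U₂ ∩ U₃ = A) :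
    μ.real U₃ᶜ * μ.real (U₁ᶜ ∩ U₂ᶜ ∩ U₃ᶜ) - μ.real (U₁ᶜ ∩ U₃ᶜ) * μ.real (U₂ᶜ ∩ U₃ᶜ) =
      -(μ.real (U₁ \ A) * μ.real (U₂ \ A)) := by
  have hA : MeasurableSet A := by rw [← h12]; exact h₁.inter h₂
  have hAU₁ : U₁ ∩ A = A := by
    rw [Set.inter_eq_right, ← h12]; exact Set.inter_subset_left
  have hAU₂ : U₂ ∩ A = A := by
    rw [Set.inter_eq_right, ← h12]; exact Set.inter_subset_right
  have d₁ : μ.real (U₁ \ A) = μ.real U₁ - μ.real A := by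
    have h := measureReal_inter_add_sdiff (μ := μ) (s := U₁) hA
    rw [hAU₁] at h
    linarith
  have d₂ : μ.real (U₂ \ A) = μ.real U₂ - μ.real A := by
    have h := measureReal_inter_add_sdiff (μ := μ) (s := U₂) hA
    rw [hAU₂] at h
    linarith
  have hU13 : μ.real (U₁ ∪ U₃) = μ.real U₁ + μ.real U₃ - μ.real A := by
    have h := measureReal_union_add_inter (μ := μ) (s := U₁) h₃
    rw [h13] at h
    linarith
  have hU23 : μ.real (U₂ ∪ U₃) = μ.real U₂ + μ.real U₃ - μ.real A := by
    have h := measureReal_union_add_inter (μ := μ) (s := U₂) h₃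
    rw [h23] at h
    linarith
  have hU123 := measureReal_union₃_of_pairwise_inter_eq μ h₂ h₃ h12 h13 h23
  have c3 : μ.real U₃ᶜ = 1 - μ.real U₃ := probReal_compl_eq_one_sub h₃
  have c13 : μ.real (U₁ᶜ ∩ U₃ᶜ) = 1 - (μ.real U₁ + μ.real U₃ - μ.real A) := by
    rw [← Set.compl_union, probReal_compl_eq_one_sub (h₁.union h₃), hU13]
  have c23 : μ.real (U₂ᶜ ∩ U₃ᶜ) = 1 - (μ.real U₂ + μ.real U₃ - μ.real A) := by
    rw [← Set.compl_union, probReal_compl_eq_one_sub (h₂.union h₃), hU23]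
  have c123 : μ.real (U₁ᶜ ∩ U₂ᶜ ∩ U₃ᶜ) =
      1 - (μ.real U₁ + μ.real U₂ + μ.real U₃ - 2 * μ.real A) := by
    rw [← Set.compl_union, ← Set.compl_union, probReal_compl_eq_one_sub ((h₁.union h₂).union h₃),
      hU123]
  rw [c123, c3, c13, c23, d₁, d₂]
  ring

/-- **Sahi's inequality on sunflower complements = "two Harris slacks pay for a petal product".**  With
the notation of `measureReal_compl_sunflower_condCov_eq`, for every probability measure:
`μ(U₃ᶜ)·E₃(U₁ᶜ,U₂ᶜ,U₃ᶜ) = −c₁c₂ + μ(U₃ᶜ)·[μ(U₁ᶜ∩U₂ᶜ∩U₃ᶜ) − μ(U₁ᶜ∩U₂ᶜ)·μ(U₃ᶜ)]`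
`  + [μ(U₁ᶜ∩U₃ᶜ) − μ(U₁ᶜ)μ(U₃ᶜ)]·[μ(U₂ᶜ∩U₃ᶜ) − μ(U₂ᶜ)μ(U₃ᶜ)]`
— Blinovsky's chain `SahiE3.mul_eq` with its conditional-covariance term evaluated by
`measureReal_compl_sunflower_condCov_eq`.  When the `U_i` are increasing events of a product (or FKG)
measure the two bracketed Harris slacks are `≥ 0` and the first term is `≤ 0`: on this family
[Kahn2022, Conjecture 5] is precisely the assertion that the slacks dominate the petal product,
equivalently `(1 + a)(ab − e₂) ≥ e₃` (`sahiE3_compl_sunflower_eq`).  (Bookkeeping; not stated in the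
sources.) [cite: Blinovsky2013, Appendix (arXiv text p. 3); Kahn2022, Conjecture 5 (arXiv p. 3)] -/
theorem sahiE3_compl_sunflower_mul_eq (h₁ : MeasurableSet U₁) (h₂ : MeasurableSet U₂)
    (h₃ : MeasurableSet U₃) (h12 : U₁ ∩ U₂ = A) (h13 : U₁ ∩ U₃ = A) (h23 : U₂ ∩ U₃ = A) :
    μ.real U₃ᶜ * sahiE3 μ U₁ᶜ U₂ᶜ U₃ᶜ =
      -(μ.real (U₁ \ A) * μ.real (U₂ \ A)) +
          μ.real U₃ᶜ * (μ.real (U₁ᶜ ∩ U₂ᶜ ∩ U₃ᶜ) - μ.real (U₁ᶜ ∩ U₂ᶜ) * μ.real U₃ᶜ) +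
        (μ.real (U₁ᶜ ∩ U₃ᶜ) - μ.real U₁ᶜ * μ.real U₃ᶜ) *
          (μ.real (U₂ᶜ ∩ U₃ᶜ) - μ.real U₂ᶜ * μ.real U₃ᶜ) := by
  have hA : MeasurableSet A := by rw [← h12]; exact h₁.inter h₂
  have hAU₁ : U₁ ∩ A = A := by
    rw [Set.inter_eq_right, ← h12]; exact Set.inter_subset_left
  have hAU₂ : U₂ ∩ A = A := by
    rw [Set.inter_eq_right, ← h12]; exact Set.inter_subset_right
  have d₁ : μ.real (U₁ \ A) = μ.real U₁ - μ.real A := by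
    have h := measureReal_inter_add_sdiff (μ := μ) (s := U₁) hA
    rw [hAU₁] at h
    linarith
  have d₂ : μ.real (U₂ \ A) = μ.real U₂ - μ.real A := by
    have h := measureReal_inter_add_sdiff (μ := μ) (s := U₂) hA
    rw [hAU₂] at h
    linarith
  have hU12 : μ.real (U₁ ∪ U₂) = μ.real U₁ + μ.real U₂ - μ.real A := by
    have h := measureReal_union_add_inter (μ := μ) (s := U₁) h₂
    rw [h12] at h
    linarith
  have hU13 : μ.real (U₁ ∪ U₃) = μ.real U₁ + μ.real U₃ - μ.real A := by
    have h := measureReal_union_add_inter (μ := μ) (s := U₁) h₃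
    rw [h13] at h
    linarith
  have hU23 : μ.real (U₂ ∪ U₃) = μ.real U₂ + μ.real U₃ - μ.real A := by
    have h := measureReal_union_add_inter (μ := μ) (s := U₂) h₃
    rw [h23] at h
    linarith
  have hU123 := measureReal_union₃_of_pairwise_inter_eq μ h₂ h₃ h12 h13 h23
  have c1 : μ.real U₁ᶜ = 1 - μ.real U₁ := probReal_compl_eq_one_sub h₁
  have c2 : μ.real U₂ᶜ = 1 - μ.real U₂ := probReal_compl_eq_one_sub h₂
  have c3 : μ.real U₃ᶜ = 1 - μ.real U₃ := probReal_compl_eq_one_sub h₃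
  have c12 : μ.real (U₁ᶜ ∩ U₂ᶜ) = 1 - (μ.real U₁ + μ.real U₂ - μ.real A) := by
    rw [← Set.compl_union, probReal_compl_eq_one_sub (h₁.union h₂), hU12]
  have c13 : μ.real (U₁ᶜ ∩ U₃ᶜ) = 1 - (μ.real U₁ + μ.real U₃ - μ.real A) := by
    rw [← Set.compl_union, probReal_compl_eq_one_sub (h₁.union h₃), hU13]
  have c23 : μ.real (U₂ᶜ ∩ U₃ᶜ) = 1 - (μ.real U₂ + μ.real U₃ - μ.real A) := by
    rw [← Set.compl_union, probReal_compl_eq_one_sub (h₂.union h₃), hU23]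
  have c123 : μ.real (U₁ᶜ ∩ U₂ᶜ ∩ U₃ᶜ) =
      1 - (μ.real U₁ + μ.real U₂ + μ.real U₃ - 2 * μ.real A) := by
    rw [← Set.compl_union, ← Set.compl_union, probReal_compl_eq_one_sub ((h₁.union h₂).union h₃),
      hU123]
  rw [sahiE3_def, c123, c1, c2, c3, c12, c13, c23, d₁, d₂]
  ring

end General

/-! ### Product measures: the proved part, via Gladkov's strong Harris–Kleitman inequality -/

section ProdBernoulli

variable {ι : Type*} [Finite ι]

/-- **The proved part of Kahn's Conjecture 5 on the complements of a sunflower.**  For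
`μ = prodBernoulli p` on `Set ι` (`ι` finite) and INCREASING events `U₁, U₂, U₃` with
`U₁ ∩ U₂ = U₁ ∩ U₃ = U₂ ∩ U₃ = A`:
`E₃(U₁ᶜ, U₂ᶜ, U₃ᶜ) ≥ −μ(U₁∖A)·μ(U₂∖A)·μ(U₃∖A)`, from `sahiE3_compl_sunflower_eq` and
[Gladkov2024StrongFKG, Thm. 2.1] (`k = 3`).  The full inequality `E₃(U₁ᶜ,U₂ᶜ,U₃ᶜ) ≥ 0`, i.e.
`(1 + μ(A))(μ(A)μ((U₁∪U₂∪U₃)ᶜ) − e₂) ≥ e₃`, is an instance of the open conjecture.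
(Corollary; not stated in the sources.) [cite: Gladkov2024StrongFKG, Thm. 2.1; Kahn2022, Conjecture 5 (arXiv p. 3)] -/
theorem prodBernoulli_sahiE3_compl_sunflower_ge (p : ι → unitInterval) {U₁ U₂ U₃ A : Set (Set ι)}
    (hU₁ : IsUpperSet U₁) (hU₂ : IsUpperSet U₂) (hU₃ : IsUpperSet U₃) (h12 : U₁ ∩ U₂ = A)
    (h13 : U₁ ∩ U₃ = A) (h23 : U₂ ∩ U₃ = A) :
    -((prodBernoulli p).real (U₁ \ A) * (prodBernoulli p).real (U₂ \ A) *
        (prodBernoulli p).real (U₃ \ A)) ≤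
      sahiE3 (prodBernoulli p) U₁ᶜ U₂ᶜ U₃ᶜ := by
  classical
  have h₁ : MeasurableSet U₁ := MeasurableSet.of_discrete
  have h₂ : MeasurableSet U₂ := MeasurableSet.of_discrete
  have h₃ : MeasurableSet U₃ := MeasurableSet.of_discrete
  rw [sahiE3_compl_sunflower_eq (prodBernoulli p) h₁ h₂ h₃ h12 h13 h23]
  have hAG := prodBernoulli_strongHarris_sunflower_three p hU₁ hU₂ hU₃ h12 h13 h23
  have ha : 0 ≤ (prodBernoulli p).real A := measureReal_nonneg
  have h1 : 0 ≤ 1 + (prodBernoulli p).real A := by linarith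
  have h2 : 0 ≤ (prodBernoulli p).real A * (prodBernoulli p).real (U₁ ∪ U₂ ∪ U₃)ᶜ -
      ((prodBernoulli p).real (U₁ \ A) * (prodBernoulli p).real (U₂ \ A) +
        (prodBernoulli p).real (U₁ \ A) * (prodBernoulli p).real (U₃ \ A) +
        (prodBernoulli p).real (U₂ \ A) * (prodBernoulli p).real (U₃ \ A)) := by
    linarith
  have h3 := mul_nonneg h1 h2
  linarith

end ProdBernoulli

end Literature.Probability.LatticeModels

/-! ### The four-point perfect-matching separation triple in bond percolation -/

namespace Literature.Probability.Percolation

open MeasureTheory Literature.Probability.LatticeModels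

variable {V : Type*}

/-- Transitivity of open connection, membership form. [folklore] -/
private theorem oc_trans {x y z : V} {ω : BondConfig V} (h₁ : ω ∈ openConn x y)
    (h₂ : ω ∈ openConn y z) : ω ∈ openConn x z :=
  SimpleGraph.Reachable.trans h₁ h₂

/-- Symmetry of open connection, membership form. [folklore] -/
private theorem oc_symm {x y : V} {ω : BondConfig V} (h : ω ∈ openConn x y) : ω ∈ openConn y x :=
  SimpleGraph.Reachable.symm h

/-- **The matching events form a sunflower (pair 1,2).**  For vertices `o, a₁, a₂, a₃`:
`({o↔a₁} ∪ {a₂↔a₃}) ∩ ({o↔a₂} ∪ {a₁↔a₃})` is the event "some three of `o, a₁, a₂, a₃` are mutually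
joined", written as `({o↔a₁}∩{o↔a₂}) ∪ ({o↔a₁}∩{o↔a₃}) ∪ ({o↔a₂}∩{o↔a₃}) ∪ ({a₁↔a₂}∩{a₁↔a₃})`.
[folklore] -/
theorem openConn_matching_inter₁₂ (o a₁ a₂ a₃ : V) :
    ((openConn o a₁ ∪ openConn a₂ a₃) ∩ (openConn o a₂ ∪ openConn a₁ a₃) : Set (BondConfig V)) =
      openConn o a₁ ∩ openConn o a₂ ∪ openConn o a₁ ∩ openConn o a₃ ∪
          openConn o a₂ ∩ openConn o a₃ ∪ openConn a₁ a₂ ∩ openConn a₁ a₃ := by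
  ext ω
  constructor
  · rintro ⟨h1 | h1, h2 | h2⟩
    · exact Or.inl (Or.inl (Or.inl ⟨h1, h2⟩))
    · exact Or.inl (Or.inl (Or.inr ⟨h1, oc_trans h1 h2⟩))
    · exact Or.inl (Or.inr ⟨h2, oc_trans h2 h1⟩)
    · exact Or.inr ⟨oc_trans h2 (oc_symm h1), h2⟩
  · rintro (((⟨h1, h2⟩ | ⟨h1, h2⟩) | ⟨h1, h2⟩) | ⟨h1, h2⟩)
    · exact ⟨Or.inl h1, Or.inl h2⟩
    · exact ⟨Or.inl h1, Or.inr (oc_trans (oc_symm h1) h2)⟩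
    · exact ⟨Or.inr (oc_trans (oc_symm h1) h2), Or.inl h1⟩
    · exact ⟨Or.inr (oc_trans (oc_symm h1) h2), Or.inr h2⟩

/-- **The matching events form a sunflower (pair 1,3).** [folklore] -/
theorem openConn_matching_inter₁₃ (o a₁ a₂ a₃ : V) :
    ((openConn o a₁ ∪ openConn a₂ a₃) ∩ (openConn o a₃ ∪ openConn a₁ a₂) : Set (BondConfig V)) =
      openConn o a₁ ∩ openConn o a₂ ∪ openConn o a₁ ∩ openConn o a₃ ∪
          openConn o a₂ ∩ openConn o a₃ ∪ openConn a₁ a₂ ∩ openConn a₁ a₃ := by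
  ext ω
  constructor
  · rintro ⟨h1 | h1, h2 | h2⟩
    · exact Or.inl (Or.inl (Or.inr ⟨h1, h2⟩))
    · exact Or.inl (Or.inl (Or.inl ⟨h1, oc_trans h1 h2⟩))
    · exact Or.inl (Or.inr ⟨oc_trans h2 (oc_symm h1), h2⟩)
    · exact Or.inr ⟨h2, oc_trans h2 h1⟩
  · rintro (((⟨h1, h2⟩ | ⟨h1, h2⟩) | ⟨h1, h2⟩) | ⟨h1, h2⟩)
    · exact ⟨Or.inl h1, Or.inr (oc_trans (oc_symm h1) h2)⟩
    · exact ⟨Or.inl h1, Or.inl h2⟩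
    · exact ⟨Or.inr (oc_trans (oc_symm h1) h2), Or.inl h2⟩
    · exact ⟨Or.inr (oc_trans (oc_symm h1) h2), Or.inr h1⟩

/-- **The matching events form a sunflower (pair 2,3).** [folklore] -/
theorem openConn_matching_inter₂₃ (o a₁ a₂ a₃ : V) :
    ((openConn o a₂ ∪ openConn a₁ a₃) ∩ (openConn o a₃ ∪ openConn a₁ a₂) : Set (BondConfig V)) =
      openConn o a₁ ∩ openConn o a₂ ∪ openConn o a₁ ∩ openConn o a₃ ∪
          openConn o a₂ ∩ openConn o a₃ ∪ openConn a₁ a₂ ∩ openConn a₁ a₃ := by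
  ext ω
  constructor
  · rintro ⟨h1 | h1, h2 | h2⟩
    · exact Or.inl (Or.inr ⟨h1, h2⟩)
    · exact Or.inl (Or.inl (Or.inl ⟨oc_trans h1 (oc_symm h2), h1⟩))
    · exact Or.inl (Or.inl (Or.inr ⟨oc_trans h2 (oc_symm h1), h2⟩))
    · exact Or.inr ⟨h2, h1⟩
  · rintro (((⟨h1, h2⟩ | ⟨h1, h2⟩) | ⟨h1, h2⟩) | ⟨h1, h2⟩)
    · exact ⟨Or.inl h2, Or.inr (oc_trans (oc_symm h1) h2)⟩
    · exact ⟨Or.inr (oc_trans (oc_symm h1) h2), Or.inl h2⟩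
    · exact ⟨Or.inl h1, Or.inl h2⟩
    · exact ⟨Or.inr h2, Or.inr h1⟩

variable [Finite V]

/-- **Sahi's `E₃` on the three perfect-matching separation events of four vertices.**  For
`μ = prodBernoulli w` and vertices `o, a₁, a₂, a₃`, let `U_k = {o↔a_k} ∪ {a_i↔a_j}` (`{i,j,k} = {1,2,3}`),
`T` = "some three of the four are mutually joined" (the common pairwise intersection of the `U_k`,
`openConn_matching_inter₁₂/₁₃/₂₃`), `Q = μ((U₁ ∪ U₂ ∪ U₃)ᶜ)` (no two of the four joined),
`R = μ(T)`, `x_k = μ(U_k ∖ T)` (the configurations whose partition of `{o,a₁,a₂,a₃}` joins one or both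
pairs of the `k`-th perfect matching and nothing else).  Then for the decreasing events
`D_k = {o↮a_k} ∩ {a_i↮a_j}`:
`E₃(D₁, D₂, D₃) = (1 + R)·(R·Q − (x₁x₂ + x₁x₃ + x₂x₃)) − x₁x₂x₃`.
(Instance of `sahiE3_compl_sunflower_eq`; not stated in the sources.)
[cite: LiebSahi2021, eq. (2.1) (arXiv p. 5); Gladkov2024StrongFKG, Thm. 2.1] -/
theorem prodBernoulli_sahiE3_fourPointMatching_eq (w : Sym2 V → unitInterval) (o a₁ a₂ a₃ : V) :
    sahiE3 (prodBernoulli w) ((openConn o a₁)ᶜ ∩ (openConn a₂ a₃)ᶜ)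
        ((openConn o a₂)ᶜ ∩ (openConn a₁ a₃)ᶜ) ((openConn o a₃)ᶜ ∩ (openConn a₁ a₂)ᶜ) =
      (1 + (prodBernoulli w).real
            (openConn o a₁ ∩ openConn o a₂ ∪ openConn o a₁ ∩ openConn o a₃ ∪
                openConn o a₂ ∩ openConn o a₃ ∪ openConn a₁ a₂ ∩ openConn a₁ a₃)) *
          ((prodBernoulli w).real
                (openConn o a₁ ∩ openConn o a₂ ∪ openConn o a₁ ∩ openConn o a₃ ∪
                    openConn o a₂ ∩ openConn o a₃ ∪ openConn a₁ a₂ ∩ openConn a₁ a₃) *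
              (prodBernoulli w).real
                ((openConn o a₁ ∪ openConn a₂ a₃) ∪ (openConn o a₂ ∪ openConn a₁ a₃) ∪
                    (openConn o a₃ ∪ openConn a₁ a₂))ᶜ -
            ((prodBernoulli w).real
                  ((openConn o a₁ ∪ openConn a₂ a₃) \
                    (openConn o a₁ ∩ openConn o a₂ ∪ openConn o a₁ ∩ openConn o a₃ ∪
                        openConn o a₂ ∩ openConn o a₃ ∪ openConn a₁ a₂ ∩ openConn a₁ a₃)) *
                (prodBernoulli w).real
                  ((openConn o a₂ ∪ openConn a₁ a₃) \
                    (openConn o a₁ ∩ openConn o a₂ ∪ openConn o a₁ ∩ openConn o a₃ ∪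
                        openConn o a₂ ∩ openConn o a₃ ∪ openConn a₁ a₂ ∩ openConn a₁ a₃)) +
              (prodBernoulli w).real
                  ((openConn o a₁ ∪ openConn a₂ a₃) \
                    (openConn o a₁ ∩ openConn o a₂ ∪ openConn o a₁ ∩ openConn o a₃ ∪
                        openConn o a₂ ∩ openConn o a₃ ∪ openConn a₁ a₂ ∩ openConn a₁ a₃)) *
                (prodBernoulli w).real
                  ((openConn o a₃ ∪ openConn a₁ a₂) \
                    (openConn o a₁ ∩ openConn o a₂ ∪ openConn o a₁ ∩ openConn o a₃ ∪
                        openConn o a₂ ∩ openConn o a₃ ∪ openConn a₁ a₂ ∩ openConn a₁ a₃)) +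
              (prodBernoulli w).real
                  ((openConn o a₂ ∪ openConn a₁ a₃) \
                    (openConn o a₁ ∩ openConn o a₂ ∪ openConn o a₁ ∩ openConn o a₃ ∪
                        openConn o a₂ ∩ openConn o a₃ ∪ openConn a₁ a₂ ∩ openConn a₁ a₃)) *
                (prodBernoulli w).real
                  ((openConn o a₃ ∪ openConn a₁ a₂) \
                    (openConn o a₁ ∩ openConn o a₂ ∪ openConn o a₁ ∩ openConn o a₃ ∪
                        openConn o a₂ ∩ openConn o a₃ ∪ openConn a₁ a₂ ∩ openConn a₁ a₃)))) -
        (prodBernoulli w).real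
              ((openConn o a₁ ∪ openConn a₂ a₃) \
                (openConn o a₁ ∩ openConn o a₂ ∪ openConn o a₁ ∩ openConn o a₃ ∪
                    openConn o a₂ ∩ openConn o a₃ ∪ openConn a₁ a₂ ∩ openConn a₁ a₃)) *
            (prodBernoulli w).real
              ((openConn o a₂ ∪ openConn a₁ a₃) \
                (openConn o a₁ ∩ openConn o a₂ ∪ openConn o a₁ ∩ openConn o a₃ ∪
                    openConn o a₂ ∩ openConn o a₃ ∪ openConn a₁ a₂ ∩ openConn a₁ a₃)) *
          (prodBernoulli w).real
            ((openConn o a₃ ∪ openConn a₁ a₂) \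
              (openConn o a₁ ∩ openConn o a₂ ∪ openConn o a₁ ∩ openConn o a₃ ∪
                  openConn o a₂ ∩ openConn o a₃ ∪ openConn a₁ a₂ ∩ openConn a₁ a₃)) := by
  classical
  have h₁ : MeasurableSet (openConn o a₁ ∪ openConn a₂ a₃ : Set (BondConfig V)) :=
    MeasurableSet.of_discrete
  have h₂ : MeasurableSet (openConn o a₂ ∪ openConn a₁ a₃ : Set (BondConfig V)) :=
    MeasurableSet.of_discrete
  have h₃ : MeasurableSet (openConn o a₃ ∪ openConn a₁ a₂ : Set (BondConfig V)) :=
    MeasurableSet.of_discrete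
  rw [← Set.compl_union, ← Set.compl_union, ← Set.compl_union]
  exact sahiE3_compl_sunflower_eq (prodBernoulli w) h₁ h₂ h₃ (openConn_matching_inter₁₂ o a₁ a₂ a₃)
    (openConn_matching_inter₁₃ o a₁ a₂ a₃) (openConn_matching_inter₂₃ o a₁ a₂ a₃)

/-- **The proved part of Kahn's Conjecture 5 on the perfect-matching separation triple.**  With the
notation of `prodBernoulli_sahiE3_fourPointMatching_eq`:
`E₃(D₁, D₂, D₃) ≥ −x₁x₂x₃`, from the sunflower structure and [Gladkov2024StrongFKG, Thm. 2.1].  (The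
full inequality `E₃(D₁,D₂,D₃) ≥ 0` is an instance of the open conjecture
[Kahn2022, Conjecture 5]; this corollary is not stated in the sources.)
[cite: Gladkov2024StrongFKG, Thm. 2.1; Kahn2022, Conjecture 5 (arXiv p. 3)] -/
theorem prodBernoulli_sahiE3_fourPointMatching_ge (w : Sym2 V → unitInterval) (o a₁ a₂ a₃ : V) :
    -((prodBernoulli w).real
            ((openConn o a₁ ∪ openConn a₂ a₃) \
              (openConn o a₁ ∩ openConn o a₂ ∪ openConn o a₁ ∩ openConn o a₃ ∪
                  openConn o a₂ ∩ openConn o a₃ ∪ openConn a₁ a₂ ∩ openConn a₁ a₃)) *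
          (prodBernoulli w).real
            ((openConn o a₂ ∪ openConn a₁ a₃) \
              (openConn o a₁ ∩ openConn o a₂ ∪ openConn o a₁ ∩ openConn o a₃ ∪
                  openConn o a₂ ∩ openConn o a₃ ∪ openConn a₁ a₂ ∩ openConn a₁ a₃)) *
        (prodBernoulli w).real
          ((openConn o a₃ ∪ openConn a₁ a₂) \
            (openConn o a₁ ∩ openConn o a₂ ∪ openConn o a₁ ∩ openConn o a₃ ∪
                openConn o a₂ ∩ openConn o a₃ ∪ openConn a₁ a₂ ∩ openConn a₁ a₃))) ≤
      sahiE3 (prodBernoulli w) ((openConn o a₁)ᶜ ∩ (openConn a₂ a₃)ᶜ)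
        ((openConn o a₂)ᶜ ∩ (openConn a₁ a₃)ᶜ) ((openConn o a₃)ᶜ ∩ (openConn a₁ a₂)ᶜ) := by
  rw [← Set.compl_union, ← Set.compl_union, ← Set.compl_union]
  exact prodBernoulli_sahiE3_compl_sunflower_ge w
    ((isUpperSet_openConn o a₁).union (isUpperSet_openConn a₂ a₃))
    ((isUpperSet_openConn o a₂).union (isUpperSet_openConn a₁ a₃))
    ((isUpperSet_openConn o a₃).union (isUpperSet_openConn a₁ a₂))
    (openConn_matching_inter₁₂ o a₁ a₂ a₃) (openConn_matching_inter₁₃ o a₁ a₂ a₃)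
    (openConn_matching_inter₂₃ o a₁ a₂ a₃)

/-- **The perfect-matching separations are pairwise negatively correlated given the third.**  For bond
percolation with arbitrary edge weights and vertices `o, a₁, a₂, a₃`, with
`D_k = (openConn o a_k ∪ openConn a_i a_j)ᶜ = {o ↮ a_k} ∩ {a_i ↮ a_j}` and the petal masses `x_k` of
`prodBernoulli_sahiE3_fourPointMatching_eq`:
`μ(D₃)·μ(D₁ ∩ D₂ ∩ D₃) − μ(D₁ ∩ D₃)·μ(D₂ ∩ D₃) = −x₁·x₂`
(given `D₃`, the events `D₁` and `D₂` are the mutually exclusive refinements "partition below the matching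
`{o a₂ | a₁ a₃}`" and "below `{o a₁ | a₂ a₃}`", meeting only in "no two of the four joined").  So the
conditional-positive-correlation route to Sahi's inequality (`SahiE3.nonneg_of_condCov`; the mechanism of
[Sahi2008, Thm. 2] / [Blinovsky2013]) is unavailable for this triple, and by `sahiE3_compl_sunflower_mul_eq`
the open instance `E₃(D₁,D₂,D₃) ≥ 0` of [Kahn2022, Conjecture 5] reads
`μ(D₃)·Cov(1_{D₁∩D₂},1_{D₃}) + Cov(1_{D₁},1_{D₃})·Cov(1_{D₂},1_{D₃}) ≥ x₁x₂`.  (Instance of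
`measureReal_compl_sunflower_condCov_eq`; not stated in the sources.)
[cite: Kahn2022, Conjecture 5 (arXiv p. 3); Blinovsky2013, Appendix (arXiv text p. 3)] -/
theorem prodBernoulli_fourPointMatching_condCov_eq (w : Sym2 V → unitInterval) (o a₁ a₂ a₃ : V) :
    (prodBernoulli w).real (openConn o a₃ ∪ openConn a₁ a₂)ᶜ *
          (prodBernoulli w).real
            ((openConn o a₁ ∪ openConn a₂ a₃)ᶜ ∩ (openConn o a₂ ∪ openConn a₁ a₃)ᶜ ∩
              (openConn o a₃ ∪ openConn a₁ a₂)ᶜ) -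
        (prodBernoulli w).real ((openConn o a₁ ∪ openConn a₂ a₃)ᶜ ∩ (openConn o a₃ ∪ openConn a₁ a₂)ᶜ) *
          (prodBernoulli w).real
            ((openConn o a₂ ∪ openConn a₁ a₃)ᶜ ∩ (openConn o a₃ ∪ openConn a₁ a₂)ᶜ) =
      -((prodBernoulli w).real
            ((openConn o a₁ ∪ openConn a₂ a₃) \
              (openConn o a₁ ∩ openConn o a₂ ∪ openConn o a₁ ∩ openConn o a₃ ∪
                  openConn o a₂ ∩ openConn o a₃ ∪ openConn a₁ a₂ ∩ openConn a₁ a₃)) *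
          (prodBernoulli w).real
            ((openConn o a₂ ∪ openConn a₁ a₃) \
              (openConn o a₁ ∩ openConn o a₂ ∪ openConn o a₁ ∩ openConn o a₃ ∪
                  openConn o a₂ ∩ openConn o a₃ ∪ openConn a₁ a₂ ∩ openConn a₁ a₃))) := by
  classical
  have h₁ : MeasurableSet (openConn o a₁ ∪ openConn a₂ a₃ : Set (BondConfig V)) :=
    MeasurableSet.of_discrete
  have h₂ : MeasurableSet (openConn o a₂ ∪ openConn a₁ a₃ : Set (BondConfig V)) :=
    MeasurableSet.of_discrete
  have h₃ : MeasurableSet (openConn o a₃ ∪ openConn a₁ a₂ : Set (BondConfig V)) :=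
    MeasurableSet.of_discrete
  exact measureReal_compl_sunflower_condCov_eq (prodBernoulli w) h₁ h₂ h₃
    (openConn_matching_inter₁₂ o a₁ a₂ a₃) (openConn_matching_inter₁₃ o a₁ a₂ a₃)
    (openConn_matching_inter₂₃ o a₁ a₂ a₃)

end Literature.Probability.Percolation
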